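import Summits.CriticalPhenomena.PercolationContinuityZ3.Theorems.PercNearOneGluingNoHeavyLowerTailAntitheticCyclePlusThresholds
import Summits.CriticalPhenomena.PercolationContinuityZ3.Theorems.PercNearOneGluingNoHeavyLowerTailAntitheticCyclePlusTraces
import Summits.CriticalPhenomena.PercolationContinuityZ3.Theorems.PercNearOneGluingNoHeavyLowerTailAntitheticBoundaryCount
import Summits.CriticalPhenomena.PercolationContinuityZ3.Theorems.PercNearOneGluingNoHeavyLowerTailAntitheticBlockTools
import HarnessLib

/-!
# `NoHeavyLowerTail` (stmt-CriticalPhenomena-4575) — antithetic cluster pairs: THEOREM C′, the BOUNDARY COUNT, part 4 — the pieces: slab reduction,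
# the bad one-change colourings land in `rbBad`/`brBad`, the good arc / co-arc / full / empty colourings (prim-hp-2 gen 44; HOME/THEOREM-Cprime-delta2-cycle.md
# §5–§6, §12 (L4))

Support file (`--supports stmt-CriticalPhenomena-4575`, hull-port prover `prim-hp-2`, gen 44).  No definitions, no named facts, no sorries; standard axioms.

SETTING: cycle `v 0 = s, …, v (n−1)`, `E₀ = Cyc.edgeSet n v`, `y = v p`, `z = v q` (`0 < p, q < n`), markers `e, f ∉ E₀`, upper sets `U, W` not containing `∅`,
lifted clusters `X(ω) = L_{y,e}(C_s(ω ∩ E₀))`, `X′(ω) = L_{z,f}(C_s(ωᶜ ∩ E₀))`, thresholds `thrP/thrQ` (…CyclePlusThresholds), index sets `rbBad, brBad, arcGood`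
(…AntitheticBoundaryCount).
* `CyclePlus.sum_nonneg_of_slab` — a summand invariant under flipping pairs of `K` has nonnegative total sum as soon as its sum over the slab `{ω : ω ∩ K = ∅}`
  is nonnegative (`Glue.sum_slab_eq`);
* `Cyc.Bulk.last_notMem_of_bad`, `last_mem_of_bad` — a non-bulk colouring with a BAD indicator pattern is one-change;
* `Cyc.Bulk.iLen_mem_rbBad`, `iLen_mem_brBad` — its position `iLen` is a bad position of the abstract count (threshold form of the memberships, kept
  condition `¬(p ≤ i ≤ q)` resp. `¬(q ≤ i ≤ p)` via `seen_iff`); `eq_of_iLen_eq_rb/br` — the position determines the colouring inside `E₀ ∪ {e,f}`;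
* `Cyc.Bulk.arc_facts`, `coarc_facts`, `full_facts`, `empty_facts` — the explicit good colourings: constraints, markers, run lengths, clusters.
[cite: VandenbergHaggstromKahn2005, §1 p. 3 (open cluster `C_s`)]
-/

noncomputable section

namespace Summit.CriticalPhenomena.PercolationContinuityZ3.Theorems

open Literature.Probability.Percolation
open scoped Classical symmDiff

namespace Antithetic

namespace CyclePlus

variable {V : Type*} [Fintype V]

/-- **Slab reduction.**  If `h` is invariant under flipping pairs inside `K` and its sum over the slab `{ω : ω ∩ K = ∅}` is nonnegative, then its total sum is
nonnegative (every slab over `θ ⊆ K` has the same sum, `Glue.sum_slab_eq`; the other fibres are empty). [this work] -/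
theorem sum_nonneg_of_slab (K : Set (Sym2 V)) (h : Set (Sym2 V) → ℝ) (hh : ∀ ω D : Set (Sym2 V), D ⊆ K → h (ω ∆ D) = h ω)
    (hpos : 0 ≤ ∑ ω ∈ Finset.univ.filter (fun ω : Set (Sym2 V) => ω ∩ K = ∅), h ω) : 0 ≤ ∑ ω, h ω := by
  rw [← Finset.sum_fiberwise_of_maps_to (s := (Finset.univ : Finset (Set (Sym2 V)))) (t := (Finset.univ : Finset (Set (Sym2 V))))
    (g := fun ω : Set (Sym2 V) => ω ∩ K) (fun _ _ => Finset.mem_univ _) h]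
  refine Finset.sum_nonneg fun θ _ => ?_
  by_cases hθ : θ ⊆ K
  · rw [Glue.sum_slab_eq K h hh hθ (Set.empty_subset K)]; exact hpos
  · refine le_of_eq (Finset.sum_eq_zero fun ω hω => ?_).symm
    rw [Finset.mem_filter] at hω
    exact absurd (hω.2 ▸ Set.inter_subset_right) hθ

end CyclePlus

namespace Cyc

namespace Bulk

variable {V : Type*} {n : ℕ} {v : ℕ → V}

section SetLemmas

omit n v in
/-- Flipping pairs outside `E` does not change the trace on `E`. [folklore] -/
theorem symmDiff_inter_of_disjoint {ω D E : Set (Sym2 V)} (hD : ∀ g ∈ E, g ∉ D) : (ω ∆ D) ∩ E = ω ∩ E := by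
  ext g
  constructor
  · rintro ⟨hg, hgE⟩; exact ⟨((mem_symmDiff_iff' ω).1 hg).2 (hD g hgE), hgE⟩
  · rintro ⟨hg, hgE⟩; exact ⟨(mem_symmDiff_iff' ω).2 (iff_of_true hg (hD g hgE)), hgE⟩

omit n v in
/-- Flipping pairs outside `E` does not change the complementary trace on `E`. [folklore] -/
theorem compl_symmDiff_inter_of_disjoint {ω D E : Set (Sym2 V)} (hD : ∀ g ∈ E, g ∉ D) : (ω ∆ D)ᶜ ∩ E = ωᶜ ∩ E := by
  ext g
  simp only [Set.mem_inter_iff, Set.mem_compl_iff, mem_symmDiff_iff' ω]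
  constructor
  · rintro ⟨hg, hgE⟩; exact ⟨fun h => hg (iff_of_true h (hD g hgE)), hgE⟩
  · rintro ⟨hg, hgE⟩; exact ⟨fun h => hg (h.2 (hD g hgE)), hgE⟩

/-- A vertex `v a`, `0 < a < n`, is not seen by the empty cluster. [this work] -/
theorem not_seen_empty (hinj : ∀ i j, i < n → j < n → v i = v j → i = j) {a : ℕ} (ha0 : 0 < a) (han : a < n) :
    ¬ (v a = v 0 ∨ ∃ g ∈ (∅ : Set (Sym2 V)), v a ∈ g) := by
  rintro (h | ⟨g, hg, -⟩)
  · exact absurd (hinj a 0 han (by omega) h) (by omega)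
  · exact hg

end SetLemmas

section Bad

variable (hn : 3 ≤ n) (hinj : ∀ i j, i < n → j < n → v i = v j → i = j) (hper : v n = v 0) {p q : ℕ} (hp0 : 0 < p) (hpn : p < n) (hq0 : 0 < q)
  (hqn : q < n) {e f : Sym2 V} {U W : Set (Set (Sym2 V))} (hU : IsUpperSet U) (hW : IsUpperSet W) (hU0 : ∅ ∉ U) (hW0 : ∅ ∉ W)
include hn hinj hper hp0 hpn hq0 hqn hU hW hU0 hW0

omit hp0 hpn hU hW in
/-- A non-bulk colouring with `edge 0` red whose lifted blue cluster lies in `U` or in `W` has `edge (n−1)` blue (else the blue cluster is empty). [this work] -/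
theorem last_notMem_of_bad {ω : Set (Sym2 V)} (h0 : edge v 0 ∈ ω) (hnb : n < iLen n v ω + jLen n v ω + 2)
    (hbad : Pendant.liftSet (v 0) (v q) f (openEdgeCluster (ωᶜ ∩ edgeSet n v) (v 0)) ∈ U ∨
      Pendant.liftSet (v 0) (v q) f (openEdgeCluster (ωᶜ ∩ edgeSet n v) (v 0)) ∈ W) : edge v (n - 1) ∉ ω := by
  intro h1
  rw [blue_empty_of_rr hn hinj hper h0 h1 hnb, Quad.liftSet_of_not (not_seen_empty hinj hq0 hqn)] at hbad
  exact hbad.elim hU0 hW0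

omit hq0 hqn hU hW in
/-- A non-bulk colouring with `edge 0` blue whose lifted red cluster lies in `U` or in `W` has `edge (n−1)` red. [this work] -/
theorem last_mem_of_bad {ω : Set (Sym2 V)} (h0 : edge v 0 ∉ ω) (hnb : n < iLen n v ω + jLen n v ω + 2)
    (hbad : Pendant.liftSet (v 0) (v p) e (openEdgeCluster (ω ∩ edgeSet n v) (v 0)) ∈ U ∨
      Pendant.liftSet (v 0) (v p) e (openEdgeCluster (ω ∩ edgeSet n v) (v 0)) ∈ W) : edge v (n - 1) ∈ ω := by
  by_contra h1
  rw [red_empty_of_bb hn hinj hper h0 h1 hnb, Quad.liftSet_of_not (not_seen_empty hinj hp0 hpn)] at hbad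
  exact hbad.elim hU0 hW0

omit hU0 hW0 in
/-- **Bad `rb` one-change colourings land in `rbBad`.**  With `X = L_{y,e}(red cluster)`, `X′ = L_{z,f}(blue cluster)`, a non-bulk colouring with `edge 0`
red, `edge (n−1)` blue, satisfying the mixed-pair constraint and with a BAD membership pattern has `iLen ∈ rbBad n p q ar cb br db` for the thresholds
`ar = thrP_{y,e} U`, `cb = thrQ_{z,f} U`, `br = thrP_{y,e} W`, `db = thrQ_{z,f} W`. [this work] -/
theorem iLen_mem_rbBad {ω : Set (Sym2 V)} (h0 : edge v 0 ∈ ω) (h1 : edge v (n - 1) ∉ ω) (hnb : n < iLen n v ω + jLen n v ω + 2)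
    (hkept : ¬ ((openGraph (ω ∩ edgeSet n v)).Reachable (v 0) (v p) ∧ (openGraph (ωᶜ ∩ edgeSet n v)).Reachable (v 0) (v q)))
    (hbad : let X := Pendant.liftSet (v 0) (v p) e (openEdgeCluster (ω ∩ edgeSet n v) (v 0))
      let X' := Pendant.liftSet (v 0) (v q) f (openEdgeCluster (ωᶜ ∩ edgeSet n v) (v 0))
      (X ∈ U ∧ X' ∉ U ∧ X ∉ W ∧ X' ∈ W) ∨ (X ∉ U ∧ X' ∈ U ∧ X ∈ W ∧ X' ∉ W)) :
    iLen n v ω ∈ BCount.rbBad n p q (thrP n v (v p) e U) (thrQ n v (v q) f U) (thrP n v (v p) e W) (thrQ n v (v q) f W) := by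
  obtain ⟨hi1, hin, -, -, hC, hC'⟩ := oneChange_rb hn hinj hper h0 h1 hnb
  set i := iLen n v ω
  rw [reach_iff_seen, reach_iff_seen, hC, hC', seen_iff hn hinj hper hp0 hpn, seen_iff hn hinj hper hq0 hqn] at hkept
  simp only [hC, hC'] at hbad
  rw [mem_iff_thrP_le hU hi1 (by omega), mem_iff_thrP_le hW hi1 (by omega), mem_iff_thrQ_le hU (j := n - i) (by omega) (by omega),
    mem_iff_thrQ_le hW (j := n - i) (by omega) (by omega)] at hbad
  rw [BCount.mem_rbBad]
  exact ⟨⟨hi1, by omega⟩, fun h => hkept ⟨Or.inl h.1, Or.inr (by omega)⟩, hbad⟩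

omit hU0 hW0 in
/-- **Bad `br` one-change colourings land in `brBad`** (thresholds `cr = thrQ_{y,e} U`, `ab = thrP_{z,f} U`, `dr = thrQ_{y,e} W`, `bb = thrP_{z,f} W`). [this work] -/
theorem iLen_mem_brBad {ω : Set (Sym2 V)} (h0 : edge v 0 ∉ ω) (h1 : edge v (n - 1) ∈ ω) (hnb : n < iLen n v ω + jLen n v ω + 2)
    (hkept : ¬ ((openGraph (ω ∩ edgeSet n v)).Reachable (v 0) (v p) ∧ (openGraph (ωᶜ ∩ edgeSet n v)).Reachable (v 0) (v q)))
    (hbad : let X := Pendant.liftSet (v 0) (v p) e (openEdgeCluster (ω ∩ edgeSet n v) (v 0))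
      let X' := Pendant.liftSet (v 0) (v q) f (openEdgeCluster (ωᶜ ∩ edgeSet n v) (v 0))
      (X ∈ U ∧ X' ∉ U ∧ X ∉ W ∧ X' ∈ W) ∨ (X ∉ U ∧ X' ∈ U ∧ X ∈ W ∧ X' ∉ W)) :
    iLen n v ω ∈ BCount.brBad n p q (thrQ n v (v p) e U) (thrP n v (v q) f U) (thrQ n v (v p) e W) (thrP n v (v q) f W) := by
  obtain ⟨hi1, hin, -, -, hC, hC'⟩ := oneChange_br hn hinj hper h0 h1 hnb
  set i := iLen n v ω
  rw [reach_iff_seen, reach_iff_seen, hC, hC', seen_iff hn hinj hper hp0 hpn, seen_iff hn hinj hper hq0 hqn] at hkept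
  simp only [hC, hC'] at hbad
  rw [mem_iff_thrQ_le hU (j := n - i) (by omega) (by omega), mem_iff_thrQ_le hW (j := n - i) (by omega) (by omega),
    mem_iff_thrP_le hU hi1 (by omega), mem_iff_thrP_le hW hi1 (by omega)] at hbad
  rw [BCount.mem_brBad]
  exact ⟨⟨hi1, by omega⟩, fun h => hkept ⟨Or.inr (by omega), Or.inl h.1⟩, hbad⟩

omit hp0 hpn hq0 hqn hU hW hU0 hW0 in
/-- Inside `E₀ ∪ {e, f}`, an `rb` one-change colouring containing `e` but not `f` is determined by its position `iLen`. [this work] -/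
theorem eq_of_iLen_eq_rb {ω ω' : Set (Sym2 V)} (hω : ω ⊆ insert e (insert f (edgeSet n v))) (hω' : ω' ⊆ insert e (insert f (edgeSet n v)))
    (heω : e ∈ ω) (heω' : e ∈ ω') (hfω : f ∉ ω) (hfω' : f ∉ ω') (h0 : edge v 0 ∈ ω) (h1 : edge v (n - 1) ∉ ω) (h0' : edge v 0 ∈ ω')
    (h1' : edge v (n - 1) ∉ ω') (hnb : n < iLen n v ω + jLen n v ω + 2) (hnb' : n < iLen n v ω' + jLen n v ω' + 2)
    (hi : iLen n v ω = iLen n v ω') : ω = ω' := by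
  obtain ⟨-, hin, hcw, hccw, -, -⟩ := oneChange_rb hn hinj hper h0 h1 hnb
  obtain ⟨-, -, hcw', hccw', -, -⟩ := oneChange_rb hn hinj hper h0' h1' hnb'
  refine eq_of_traces hω hω' heω heω' hfω hfω' fun k hk => ?_
  have a := edge_mem_iff_of_runs (c := True) hcw (by simpa using hccw) hk
  have b := edge_mem_iff_of_runs (c := True) hcw' (by simpa using hccw') hk
  rw [hi] at a
  simp only [iff_true] at a b
  rw [a, b]

omit hp0 hpn hq0 hqn hU hW hU0 hW0 in
/-- Inside `E₀ ∪ {e, f}`, a `br` one-change colouring containing `e` but not `f` is determined by its position `iLen`. [this work] -/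
theorem eq_of_iLen_eq_br {ω ω' : Set (Sym2 V)} (hω : ω ⊆ insert e (insert f (edgeSet n v))) (hω' : ω' ⊆ insert e (insert f (edgeSet n v)))
    (heω : e ∈ ω) (heω' : e ∈ ω') (hfω : f ∉ ω) (hfω' : f ∉ ω') (h0 : edge v 0 ∉ ω) (h1 : edge v (n - 1) ∈ ω) (h0' : edge v 0 ∉ ω')
    (h1' : edge v (n - 1) ∈ ω') (hnb : n < iLen n v ω + jLen n v ω + 2) (hnb' : n < iLen n v ω' + jLen n v ω' + 2)
    (hi : iLen n v ω = iLen n v ω') : ω = ω' := by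
  obtain ⟨-, hin, hcw, hccw, -, -⟩ := oneChange_br hn hinj hper h0 h1 hnb
  obtain ⟨-, -, hcw', hccw', -, -⟩ := oneChange_br hn hinj hper h0' h1' hnb'
  refine eq_of_traces hω hω' heω heω' hfω hfω' fun k hk => ?_
  have a := edge_mem_iff_of_runs (c := False) hcw (by simpa using hccw) hk
  have b := edge_mem_iff_of_runs (c := False) hcw' (by simpa using hccw') hk
  rw [hi] at a
  simp only [iff_false] at a b
  rw [← not_iff_not, a, b]

end Bad

section Good

variable [Fintype V] (hn : 3 ≤ n) (hinj : ∀ i j, i < n → j < n → v i = v j → i = j) (hper : v n = v 0) {p q : ℕ} (hp0 : 0 < p) (hpn : p < n)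
  (hq0 : 0 < q) (hqn : q < n) (R : Set V) (hRs : v 0 ∉ R) {e f : Sym2 V} (he : e ∉ edgeSet n v) (hf : f ∉ edgeSet n v) (hef : e ≠ f)
include hn hinj hper hp0 hpn hq0 hqn hRs he hf hef

omit hp0 hpn in
/-- **The ARC colouring** `ω = insert e (runSet k (n−1−k))` (`1 ≤ k ≤ n−2`): in `tset(R, ∅)`, `e ∈ ω ∌ f`, mixed-pair constraint, non-bulk, inside `E₀ ∪ {e,f}`,
`edge 0 ∈ ω`, `iLen = k`, red cluster `runSet k (n−1−k)`, blue cluster `∅`. [this work] -/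
theorem arc_facts {k : ℕ} (hk1 : 1 ≤ k) (hk2 : k + 2 ≤ n) :
    let ω : Set (Sym2 V) := insert e (runSet n v k (n - 1 - k))
    ω ∈ Peel.tset (edgeSet n v) (v 0) R ∅ ∧ e ∈ ω ∧ f ∉ ω ∧
      ¬ ((openGraph (ω ∩ edgeSet n v)).Reachable (v 0) (v p) ∧ (openGraph (ωᶜ ∩ edgeSet n v)).Reachable (v 0) (v q)) ∧
      n < iLen n v ω + jLen n v ω + 2 ∧ ω ⊆ insert e (insert f (edgeSet n v)) ∧ edge v 0 ∈ ω ∧ iLen n v ω = k ∧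
      openEdgeCluster (ω ∩ edgeSet n v) (v 0) = runSet n v k (n - 1 - k) ∧ openEdgeCluster (ωᶜ ∩ edgeSet n v) (v 0) = ∅ := by
  intro ω
  obtain ⟨hC, hC'⟩ := clusters_arc hn hinj hper (arc_cwRun hn hinj hper he hk2) (arc_ccwRun hn hinj hper he hk2) hk1 hk2
  have hz : ¬ (openGraph (ωᶜ ∩ edgeSet n v)).Reachable (v 0) (v q) := by
    rw [reach_iff_seen, hC']; exact not_seen_empty hinj hq0 hqn
  refine ⟨mem_tset_of_blue_empty R hRs hC', Set.mem_insert _ _, ?_, fun h => hz h.2, ?_, ?_, ?_, iLen_arc hn hinj hper he hk1 hk2, hC, hC'⟩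
  · rintro (h | ⟨k', hk', h, -⟩)
    · exact hef h.symm
    · exact hf (h ▸ ⟨k', hk', rfl⟩)
  · rw [iLen_arc hn hinj hper he hk1 hk2, jLen_arc hn hinj hper he hk1 hk2]; omega
  · exact Set.insert_subset_insert fun g ⟨k', hk', hg, _⟩ => Set.mem_insert_of_mem _ ⟨k', hk', hg⟩
  · exact (edge_mem_arc_iff hn hinj hper he (by omega)).2 (Or.inl (by omega))

omit hq0 hqn in
/-- **The CO-ARC colouring** `ω = insert e {edge k}` (`1 ≤ k ≤ n−2`): as above with `edge 0 ∉ ω`, red cluster `∅`, blue cluster `runSet k (n−1−k)`. [this work] -/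
theorem coarc_facts {k : ℕ} (hk1 : 1 ≤ k) (hk2 : k + 2 ≤ n) :
    let ω : Set (Sym2 V) := insert e {edge v k}
    ω ∈ Peel.tset (edgeSet n v) (v 0) R ∅ ∧ e ∈ ω ∧ f ∉ ω ∧
      ¬ ((openGraph (ω ∩ edgeSet n v)).Reachable (v 0) (v p) ∧ (openGraph (ωᶜ ∩ edgeSet n v)).Reachable (v 0) (v q)) ∧
      n < iLen n v ω + jLen n v ω + 2 ∧ ω ⊆ insert e (insert f (edgeSet n v)) ∧ edge v 0 ∉ ω ∧ iLen n v ω = k ∧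
      openEdgeCluster (ω ∩ edgeSet n v) (v 0) = ∅ ∧ openEdgeCluster (ωᶜ ∩ edgeSet n v) (v 0) = runSet n v k (n - 1 - k) := by
  intro ω
  obtain ⟨hC, hC'⟩ := clusters_coarc hn hinj hper (coarc_cwRun hn hinj hper he hk2) (coarc_ccwRun hn hinj hper he hk2) hk1 hk2
  have hy : ¬ (openGraph (ω ∩ edgeSet n v)).Reachable (v 0) (v p) := by
    rw [reach_iff_seen, hC]; exact not_seen_empty hinj hp0 hpn
  refine ⟨mem_tset_of_red_empty R hRs hC, Set.mem_insert _ _, ?_, fun h => hy h.1, ?_, ?_, ?_, iLen_coarc hn hinj hper he hk1 hk2, hC, hC'⟩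
  · rintro (h | h)
    · exact hef h.symm
    · exact hf (h ▸ ⟨k, by omega, rfl⟩)
  · rw [iLen_coarc hn hinj hper he hk1 hk2, jLen_coarc hn hinj hper he hk1 hk2]; omega
  · exact Set.insert_subset_insert fun g hg => Set.mem_insert_of_mem _ (hg ▸ ⟨k, by omega, rfl⟩)
  · exact fun h => absurd ((edge_mem_coarc_iff hn hinj hper he (by omega) (by omega)).1 h) (by omega)

omit hp0 hpn he in
/-- **The FULL colouring** `ω = insert e E₀`: as above with `edge 0 ∈ ω`, `iLen = n`, red cluster `runSet n n`, blue cluster `∅`. [this work] -/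
theorem full_facts :
    let ω : Set (Sym2 V) := insert e (edgeSet n v)
    ω ∈ Peel.tset (edgeSet n v) (v 0) R ∅ ∧ e ∈ ω ∧ f ∉ ω ∧
      ¬ ((openGraph (ω ∩ edgeSet n v)).Reachable (v 0) (v p) ∧ (openGraph (ωᶜ ∩ edgeSet n v)).Reachable (v 0) (v q)) ∧
      n < iLen n v ω + jLen n v ω + 2 ∧ ω ⊆ insert e (insert f (edgeSet n v)) ∧ edge v 0 ∈ ω ∧ iLen n v ω = n ∧
      openEdgeCluster (ω ∩ edgeSet n v) (v 0) = runSet n v n n ∧ openEdgeCluster (ωᶜ ∩ edgeSet n v) (v 0) = ∅ := by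
  intro ω
  obtain ⟨hC, hC'⟩ := clusters_full hn hinj hper (ω := ω) full_cwRun full_ccwRun
  have hz : ¬ (openGraph (ωᶜ ∩ edgeSet n v)).Reachable (v 0) (v q) := by
    rw [reach_iff_seen, hC']; exact not_seen_empty hinj hq0 hqn
  refine ⟨mem_tset_of_blue_empty R hRs hC', Set.mem_insert _ _, ?_, fun h => hz h.2, ?_, ?_, Set.mem_insert_of_mem _ ⟨0, by omega, rfl⟩,
    iLen_full hn, hC, hC'⟩
  · rintro (h | h)
    · exact hef h.symm
    · exact hf h
  · rw [iLen_full hn, jLen_full hn]; omega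
  · exact Set.insert_subset_insert fun g hg => Set.mem_insert_of_mem _ hg

omit hq0 hqn hf in
/-- **The EMPTY colouring** `ω = {e}`: as above with `edge 0 ∉ ω`, `iLen = n`, red cluster `∅`, blue cluster `runSet n n`. [this work] -/
theorem empty_facts :
    let ω : Set (Sym2 V) := {e}
    ω ∈ Peel.tset (edgeSet n v) (v 0) R ∅ ∧ e ∈ ω ∧ f ∉ ω ∧
      ¬ ((openGraph (ω ∩ edgeSet n v)).Reachable (v 0) (v p) ∧ (openGraph (ωᶜ ∩ edgeSet n v)).Reachable (v 0) (v q)) ∧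
      n < iLen n v ω + jLen n v ω + 2 ∧ ω ⊆ insert e (insert f (edgeSet n v)) ∧ edge v 0 ∉ ω ∧ iLen n v ω = n ∧
      openEdgeCluster (ω ∩ edgeSet n v) (v 0) = ∅ ∧ openEdgeCluster (ωᶜ ∩ edgeSet n v) (v 0) = runSet n v n n := by
  intro ω
  obtain ⟨hC, hC'⟩ := clusters_cofull hn hinj hper (ω := ω) (empty_cwRun he) (empty_ccwRun he)
  have hy : ¬ (openGraph (ω ∩ edgeSet n v)).Reachable (v 0) (v p) := by
    rw [reach_iff_seen, hC]; exact not_seen_empty hinj hp0 hpn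
  refine ⟨mem_tset_of_red_empty R hRs hC, Set.mem_singleton _, fun h => hef (Set.mem_singleton_iff.1 h).symm, fun h => hy h.1, ?_,
    Set.singleton_subset_iff.2 (Set.mem_insert _ _), fun h => edge_ne_of_notMem he (by omega) (Set.mem_singleton_iff.1 h), iLen_empty hn he, hC, hC'⟩
  rw [iLen_empty hn he, jLen_empty hn he]; omega

end Good

end Bulk

end Cyc

end Antithetic

end Summit.CriticalPhenomena.PercolationContinuityZ3.Theorems
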